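import Summits.CriticalPhenomena.PercolationContinuityZ3.Theorems.Transplant.SkelCellsConcG
import HarnessLib

/-!
# The `hout` side-conditions of the subbox reductions for the cell geometry of record `Skel.cellGeomSG` — generic twin of
# `KNCellsBoxProdZ2ConcHout`: over a planar skeleton they are DEPTH bounds (a vertex of the lineage's own sets lies in the graph ball
# `B_G(w₀, R)` as soon as `R` dominates the radii of those sets), to be fed to `Skel.isSubbox_Wcor_win` / `isSubbox_Wt_win` (`SkelTubeSub`)

builds on p205010 (kernel theorem, internal audit signed; external expert review pending) — nothing in this file uses p205010.
Lane `prim-bschramm-*`, seat `prim-bschramm-p2` (gen 3); helper file (`--supports stmt-CriticalPhenomena-4575`).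

* `mem_graphBall_of_mem_Ewv` — `x ∈ E_{v,x}` (between-box span ∪ next-cube span at anchor `α`) and `rB α v δ ≤ R`, `rQ α (v+δ) ≤ R` ⇒ `x ∈ B_G(w₀, R)`;
* **`mem_graphBall_of_mem_Ewv_Hfull`** — the hreach habitat `E_{v,x} ∪ H_{x,·}` (corridor span at anchor `β`, profile `ρ β x du ≤ R`): the
  `hout` input of `Skel.isSubbox_Wcor_win`;
* **`mem_graphBall_of_mem_Ewv_Efar`** — the `cond_j` habitat `E_{v,x} ∪ E^far_β(x,du)` (`rE β x du ≤ R`): the `hout` input of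
  `Skel.isSubbox_Wt_win`.  NOTE (port remark, §p2 / lane INBOX 19:1xZ): the product took the THIN window `B(w₀, F)` here using that an
  `E_{v,x}`-neighbour of the far region is joined by a planar edge; over a skeleton the window must also cover `E_{v,x}` (`R ≥ rB, rQ'`).
[cite: KozmaNitzan2024, §4 p. 17 (subbox), p. 31 (Step IV)] [cite: GrimmettPercolation1999, §7.2]
-/

noncomputable section

open scoped Classical

namespace Summit.CriticalPhenomena.PercolationContinuityZ3.Theorems

namespace Transplant

namespace Skel

open Literature.Probability.Percolation Literature.Probability.LatticeModels SimpleGraph KNCells PlanarSkeletonConc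
open Literature.Barriers.CriticalPhenomena (graphBall graphBall_mono)
open BoxProdZ2 (ConcRadiiG)

variable {V : Type} [DecidableEq V] {G : SimpleGraph V} [G.LocallyFinite] (Φ : PlanarSkeletonConc G)
variable {C : PCells} {w₀ : V} {Λ : ConcRadiiG}

/-- **`E_{v,x}` lies in the ball of radius `R`** once `R` dominates the between-box radius and the next cube's radius. [folklore] -/
theorem mem_graphBall_of_mem_Ewv {α : ℕ} {v : Site 2} {δ : MDir} {R : ℕ} (hB : Λ.rB α v δ ≤ R) (hQ : Λ.rQ α (v + stepVec δ) ≤ R)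
    {x : V} (hx : x ∈ (cellGeomSG Φ C w₀ Λ).Ewv α v δ) : x ∈ graphBall G w₀ R := by
  rw [CellGeom.Ewv] at hx
  rcases Finset.mem_union.1 hx with hx | hx
  · exact graphBall_mono G w₀ hB (mem_graphBall_of_mem_VWin hx)
  · exact graphBall_mono G w₀ hQ (mem_graphBall_of_mem_VWin hx)

/-- **The hreach habitat `E_{v,x} ∪ H_{x,·}` lies in the ball of radius `R`** once `R` dominates `rB α v δ`, `rQ α (v+δ)` and the corridor profile
`ρ β (v+δ) du ·` — the `hout` input of `Skel.isSubbox_Wcor_win` (with `KNCells2SepQ.mem_of_adj_fresh` inside it). [cite: KozmaNitzan2024, §4 p. 31] -/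
theorem mem_graphBall_of_mem_Ewv_Hfull {α β : ℕ} {v : Site 2} {δ du : MDir} {R : ℕ}
    (hB : Λ.rB α v δ ≤ R) (hQ : Λ.rQ α (v + stepVec δ) ≤ R) (hρ : ∀ ℓ, Λ.ρ β (v + stepVec δ) du ℓ ≤ R)
    {x : V} (hx : x ∈ (cellGeomSG Φ C w₀ Λ).Ewv α v δ ∪ (faceDataSG Φ C w₀ Λ).Hfull β (v + stepVec δ) du) : x ∈ graphBall G w₀ R := by
  rcases Finset.mem_union.1 hx with hx | hx
  · exact mem_graphBall_of_mem_Ewv Φ hB hQ hx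
  · change x ∈ Φ.VStair w₀ (C.Hfull (v + stepVec δ) du) (prof C Λ β (v + stepVec δ) du) at hx
    exact graphBall_mono G w₀ (hρ _) (mem_of_mem_VStair hx).2

/-- **The `cond_j` habitat `E_{v,x} ∪ E^far_β(x,du)` lies in the ball of radius `R`** once `R` dominates `rB α v δ`, `rQ α (v+δ)` and
`rE β (v+δ) du` — the `hout` input of `Skel.isSubbox_Wt_win`. [cite: KozmaNitzan2024, §4 p. 30 (Step III)] -/
theorem mem_graphBall_of_mem_Ewv_Efar {α β : ℕ} {v : Site 2} {δ du : MDir} {R : ℕ}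
    (hB : Λ.rB α v δ ≤ R) (hQ : Λ.rQ α (v + stepVec δ) ≤ R) (hE : Λ.rE β (v + stepVec δ) du ≤ R)
    {x : V} (hx : x ∈ (cellGeomSG Φ C w₀ Λ).Ewv α v δ ∪ (cellGeomSG Φ C w₀ Λ).Efar β (v + stepVec δ) du) : x ∈ graphBall G w₀ R := by
  rcases Finset.mem_union.1 hx with hx | hx
  · exact mem_graphBall_of_mem_Ewv Φ hB hQ hx
  · change x ∈ Φ.VWin w₀ (C.EfarN (v + stepVec δ) du) (Λ.rE β (v + stepVec δ) du) at hx
    exact graphBall_mono G w₀ hE (mem_graphBall_of_mem_VWin hx)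

/-- The `hout` hypothesis of `Skel.isSubbox_Wcor_win` in the shape it is consumed (any fresh region `Dd`, any adjacency). [folklore] -/
theorem hout_Wcor {α β : ℕ} {v : Site 2} {δ du : MDir} {R : ℕ}
    (hB : Λ.rB α v δ ≤ R) (hQ : Λ.rQ α (v + stepVec δ) ≤ R) (hρ : ∀ ℓ, Λ.ρ β (v + stepVec δ) du ℓ ≤ R) (Dd : Finset V) :
    ∀ y ∈ Dd, ∀ x ∈ (cellGeomSG Φ C w₀ Λ).Ewv α v δ ∪ (faceDataSG Φ C w₀ Λ).Hfull β (v + stepVec δ) du,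
      G.Adj x y → x ∈ graphBall G w₀ R :=
  fun _ _ _ hx _ => mem_graphBall_of_mem_Ewv_Hfull Φ hB hQ hρ hx

/-- The `hout` hypothesis of `Skel.isSubbox_Wt_win` in the shape it is consumed. [folklore] -/
theorem hout_Wt {α β : ℕ} {v : Site 2} {δ du : MDir} {R : ℕ}
    (hB : Λ.rB α v δ ≤ R) (hQ : Λ.rQ α (v + stepVec δ) ≤ R) (hE : Λ.rE β (v + stepVec δ) du ≤ R) (Dd : Finset V) :
    ∀ y ∈ Dd, ∀ x ∈ (cellGeomSG Φ C w₀ Λ).Ewv α v δ ∪ (cellGeomSG Φ C w₀ Λ).Efar β (v + stepVec δ) du,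
      G.Adj x y → x ∈ graphBall G w₀ R :=
  fun _ _ _ hx _ => mem_graphBall_of_mem_Ewv_Efar Φ hB hQ hE hx

/-- Every region of `cellGeomSG` lies in the ball of its own radius; in particular a fresh region `Dd ⊆ Q_b(x) ∪ E^far_{a'}(x, du)` lies in
`B_G(w₀, R)` once `rQ b x ≤ R` and `rE a' x du ≤ R` (the `hπ` input of the subbox lemmas). [folklore] -/
theorem hπ_of_subset_habitat {b a' : ℕ} {x : Site 2} {du : MDir} {R : ℕ} (hQ : Λ.rQ b x ≤ R) (hE : Λ.rE a' x du ≤ R)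
    {Dd : Finset V} (hD : Dd ⊆ (cellGeomSG Φ C w₀ Λ).Q b x ∪ (cellGeomSG Φ C w₀ Λ).Efar a' x du) :
    ∀ u ∈ Dd, u ∈ graphBall G w₀ R := by
  intro u hu
  rcases Finset.mem_union.1 (hD hu) with h | h
  · exact graphBall_mono G w₀ hQ (mem_graphBall_of_mem_VWin h)
  · exact graphBall_mono G w₀ hE (mem_graphBall_of_mem_VWin h)

end Skel

end Transplant

end Summit.CriticalPhenomena.PercolationContinuityZ3.Theorems

end
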